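import Mathlib
import Summits.Schanuel.Schanuel.Theorems.SoloInformedDenisTransfer
import Summits.Schanuel.Schanuel.Theorems.RigidCoreSchanuelOnLogFreeCoreCalibrationR
import Literature.NumberTheory.Transcendental.PeriodsWave0Proofs
import Literature.NumberTheory.Transcendental.PeriodsWave0NesterenkoProofs

/-!
# The exchange web at `(e, π)`: what the counterexample world inherits

Soloist seat `solo-Schanuel-informed`, session 13 (negation lens at the first open rung;
atlas §1 F4″ / §3 census (s13)).

Suppose the first open rung of Schanuel's conjecture fails at the emblematic point, i.e. `e` and
`π` are algebraically DEPENDENT (`¬ ExpOnePiAlgebraicIndependent`). Since both numbers are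
transcendental, `acl ℚ(e) = acl ℚ(π)` is then one algebraically closed field of transcendence
degree `1`, and by matroid exchange (`algebraicIndependent_pair_exchange`, session 6) the two
numbers become INTERCHANGEABLE in every pair statement:
`AI(π, x) ↔ AI(e, x)` for every complex `x` (`algebraicIndependent_pair_iff_of_not_expOnePi`).

Consequently every one-number engine that reaches `π` also reaches `e` in that world, and vice
versa. Run through the tree's PROVED theorems this gives unconditional DISJUNCTIONS, each with an
escape through a number whose status is open:

* Nesterenko 1996 (tree `nesterenko_holds`, `nesterenko'_holds`: `π, e^π, Γ(1/4)` and
  `π, e^{π√3}, Γ(1/3)` algebraically independent) ⟹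
  `AI(e, π) ∨ AI(e, e^π)`, `AI(e, π) ∨ AI(e, Γ(1/4))`, `AI(e, π) ∨ AI(e, e^{π√3})`,
  `AI(e, π) ∨ AI(e, Γ(1/3))`;
* Lindemann–Weierstrass (tree `algebraicIndependent_exp_holds`) ⟹ for every algebraic `α` with
  `1, α` linearly independent over `ℚ`: `AI(π, e) ∨ AI(π, e^α)` (session 6 had `α = i`).

So the only engine in print that produces algebraic independence at transcendental points
(Nesterenko's, atlas E4) returns, aimed at `(1, iπ)`, a disjunction of exactly the same shape as
Baker's and Brownawell–Waldschmidt's at the torsion floor (session 12, `floor_disjunctions`):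
the escape `AI(e, e^π)` is the instance `(1, π, iπ)` of `SC(3)` and is open. The summary
`counterexampleWorld_inherits` lists what the world `¬ AI(e, π)` satisfies; none of it is
refutable by a theorem about one of the two numbers alone — a proof of `e ⟂ π` must read the
pair jointly (atlas §3 S2).

No new definitions. Statements over Mathlib's `AlgebraicIndependent`, the tree's open
`Literature.NumberTheory.Transcendental.ExpOnePiAlgebraicIndependent` and its proved
`nesterenko_holds`, `nesterenko'_holds`, `transcendental_rat_cexp_one`, and the landed
`RigidCore.CalibrationR.transcendental_pi_complex` (reused by name, as the gate's dedup requires).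

References: [NesterenkoPhilippon2001] LNM 1752, Ch. 3 Thm 1.1, Cor. 1.2; Ch. 1 Cor. 3.2
(PDF pp. 19, 39); [Waldschmidt2008EllipticSurvey] §5.6 Cor. 48–49; matroid exchange [folklore].
-/

noncomputable section

open Complex
open Literature.NumberTheory.Transcendental (ExpOnePiAlgebraicIndependent nesterenko nesterenko'
  nesterenko_holds nesterenko'_holds transcendental_rat_cexp_one)

namespace Summit.Schanuel.Schanuel.Theorems

/-! ### Small helpers -/

/-- Swap the two entries of an algebraically independent pair. [folklore] -/
theorem soloAlgebraicIndependent_pair_swap {u v : ℂ} (h : AlgebraicIndependent ℚ ![u, v]) :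
    AlgebraicIndependent ℚ ![v, u] := by
  have h' := h.comp ![(1 : Fin 2), 0] (by decide)
  convert h' using 1
  funext i; fin_cases i <;> rfl

/-- The first two entries of an algebraically independent real triple, as a complex pair.
[folklore] -/
theorem soloAlgebraicIndependent_pair01_of_real_triple {a b c : ℝ}
    (h : AlgebraicIndependent ℚ ![a, b, c]) :
    AlgebraicIndependent ℚ ![(a : ℂ), (b : ℂ)] := by
  have h2 : AlgebraicIndependent ℚ ![a, b] := by
    have h' := h.comp ![(0 : Fin 3), 1] (by decide)
    convert h' using 1
    funext i; fin_cases i <;> rfl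
  have hC := h2.map' (f := Complex.ofRealAm.restrictScalars ℚ) Complex.ofReal_injective
  convert hC using 1
  funext i; fin_cases i <;> rfl

/-- The first and third entries of an algebraically independent real triple, as a complex pair.
[folklore] -/
theorem soloAlgebraicIndependent_pair02_of_real_triple {a b c : ℝ}
    (h : AlgebraicIndependent ℚ ![a, b, c]) :
    AlgebraicIndependent ℚ ![(a : ℂ), (c : ℂ)] := by
  have h2 : AlgebraicIndependent ℚ ![a, c] := by
    have h' := h.comp ![(0 : Fin 3), 2] (by decide)
    convert h' using 1
    funext i; fin_cases i <;> rfl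
  have hC := h2.map' (f := Complex.ofRealAm.restrictScalars ℚ) Complex.ofReal_injective
  convert hC using 1
  funext i; fin_cases i <;> rfl

/-! ### The counterexample world: `e` and `π` interchangeable -/

/-- **Exchange web.** If `e` and `π` are algebraically dependent, then for every complex `x` the
pair `(π, x)` is algebraically independent iff `(e, x)` is: in the world `¬ AI(e, π)` the two
numbers generate the same algebraically closed field of transcendence degree `1`. [this file] -/
theorem algebraicIndependent_pair_iff_of_not_expOnePi (h : ¬ ExpOnePiAlgebraicIndependent)
    (x : ℂ) :
    AlgebraicIndependent ℚ ![(Real.pi : ℂ), x] ↔ AlgebraicIndependent ℚ ![cexp 1, x] := by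
  rw [expOnePiAlgebraicIndependent_iff_complex] at h
  constructor
  · intro hx
    rcases algebraicIndependent_pair_exchange transcendental_rat_cexp_one hx with h1 | h1
    · exact absurd (soloAlgebraicIndependent_pair_swap h1) h
    · exact h1
  · intro hx
    rcases algebraicIndependent_pair_exchange RigidCore.CalibrationR.transcendental_pi_complex hx with h1 | h1
    · exact absurd h1 h
    · exact h1

/-! ### Nesterenko's engine aimed at `(1, iπ)`: disjunctions -/

/-- Nesterenko's pair `(π, e^π)` in complex form (from the tree's proved `nesterenko_holds`). -/
theorem soloAlgebraicIndependent_pi_expPi :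
    AlgebraicIndependent ℚ ![(Real.pi : ℂ), cexp (Real.pi : ℂ)] := by
  have hN : AlgebraicIndependent ℚ ![Real.pi, Real.exp Real.pi, Real.Gamma (1 / 4)] :=
    nesterenko_holds
  have h := soloAlgebraicIndependent_pair01_of_real_triple hN
  convert h using 1
  funext i; fin_cases i <;> simp [Complex.ofReal_exp]

/-- Nesterenko's pair `(π, e^{π√3})` in complex form (from the tree's proved `nesterenko'_holds`). -/
theorem soloAlgebraicIndependent_pi_expPiSqrtThree :
    AlgebraicIndependent ℚ ![(Real.pi : ℂ), cexp ((Real.pi : ℂ) * (Real.sqrt 3 : ℂ))] := by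
  have hN : AlgebraicIndependent ℚ
      ![Real.pi, Real.exp (Real.pi * Real.sqrt 3), Real.Gamma (1 / 3)] := nesterenko'_holds
  have h := soloAlgebraicIndependent_pair01_of_real_triple hN
  convert h using 1
  funext i; fin_cases i <;> simp [Complex.ofReal_exp, Complex.ofReal_mul]

/-- **`AI(e, π) ∨ AI(e, e^π)`.** At least one of the pairs `(e, π)`, `(e, e^π)` is algebraically
independent — Nesterenko's `π ⟂ e^π`, the transcendence of `e`, and exchange. Both disjuncts are
open consequences of Schanuel's conjecture (instances `(1, iπ)` of `SC(2)` and `(1, π, iπ)` of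
`SC(3)`). [this file] -/
theorem algebraicIndependent_expOne_pi_or_expOne_expPi :
    AlgebraicIndependent ℚ ![cexp 1, (Real.pi : ℂ)] ∨
      AlgebraicIndependent ℚ ![cexp 1, cexp (Real.pi : ℂ)] :=
  algebraicIndependent_pair_exchange transcendental_rat_cexp_one soloAlgebraicIndependent_pi_expPi

/-- **`AI(e, π) ∨ AI(e, Γ(1/4))`.** [this file] -/
theorem algebraicIndependent_expOne_pi_or_expOne_gammaQuarter :
    AlgebraicIndependent ℚ ![cexp 1, (Real.pi : ℂ)] ∨
      AlgebraicIndependent ℚ ![cexp 1, ((Real.Gamma (1 / 4) : ℝ) : ℂ)] := by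
  have hN : AlgebraicIndependent ℚ ![Real.pi, Real.exp Real.pi, Real.Gamma (1 / 4)] :=
    nesterenko_holds
  exact algebraicIndependent_pair_exchange transcendental_rat_cexp_one
    (soloAlgebraicIndependent_pair02_of_real_triple hN)

/-- **`AI(e, π) ∨ AI(e, e^{π√3})`.** [this file] -/
theorem algebraicIndependent_expOne_pi_or_expOne_expPiSqrtThree :
    AlgebraicIndependent ℚ ![cexp 1, (Real.pi : ℂ)] ∨
      AlgebraicIndependent ℚ ![cexp 1, cexp ((Real.pi : ℂ) * (Real.sqrt 3 : ℂ))] :=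
  algebraicIndependent_pair_exchange transcendental_rat_cexp_one
    soloAlgebraicIndependent_pi_expPiSqrtThree

/-- **`AI(e, π) ∨ AI(e, Γ(1/3))`.** [this file] -/
theorem algebraicIndependent_expOne_pi_or_expOne_gammaThird :
    AlgebraicIndependent ℚ ![cexp 1, (Real.pi : ℂ)] ∨
      AlgebraicIndependent ℚ ![cexp 1, ((Real.Gamma (1 / 3) : ℝ) : ℂ)] := by
  have hN : AlgebraicIndependent ℚ
      ![Real.pi, Real.exp (Real.pi * Real.sqrt 3), Real.Gamma (1 / 3)] := nesterenko'_holds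
  exact algebraicIndependent_pair_exchange transcendental_rat_cexp_one
    (soloAlgebraicIndependent_pair02_of_real_triple hN)

/-! ### Lindemann–Weierstrass aimed at `(1, iπ)`: the whole algebraic family -/

/-- **`AI(π, e) ∨ AI(π, e^α)` for every algebraic `α` with `1, α` linearly independent over `ℚ`**
(session 6 recorded the case `α = i`). [this file] -/
theorem algebraicIndependent_pi_expOne_or_pi_exp_of_isAlgebraic {α : ℂ} (hα : IsAlgebraic ℚ α)
    (hli : LinearIndependent ℚ ![(1 : ℂ), α]) :
    AlgebraicIndependent ℚ ![(Real.pi : ℂ), cexp 1] ∨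
      AlgebraicIndependent ℚ ![(Real.pi : ℂ), cexp α] :=
  algebraicIndependent_exp_pair_exchange RigidCore.CalibrationR.transcendental_pi_complex isAlgebraic_one hα hli

/-! ### Summary: what the world `¬ AI(e, π)` satisfies -/

/-- **The counterexample world inherits every one-number theorem.** If `e` and `π` are
algebraically dependent, then `e` is algebraically independent of `e^π`, of `Γ(1/4)`, of
`e^{π√3}` and of `Γ(1/3)` (Nesterenko transported through `acl ℚ(e) = acl ℚ(π)`), and `π` is
algebraically independent of `e^α` for every algebraic `α` with `1, α` `ℚ`-linearly independent
(Lindemann–Weierstrass transported the other way). Each conclusion is an open consequence of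
Schanuel's conjecture; none is refutable by current knowledge, which is the precise sense in which
no conjunction of one-number theorems decides `e ⟂ π`. [this file] -/
theorem counterexampleWorld_inherits (h : ¬ ExpOnePiAlgebraicIndependent) :
    AlgebraicIndependent ℚ ![cexp 1, cexp (Real.pi : ℂ)] ∧
    AlgebraicIndependent ℚ ![cexp 1, ((Real.Gamma (1 / 4) : ℝ) : ℂ)] ∧
    AlgebraicIndependent ℚ ![cexp 1, cexp ((Real.pi : ℂ) * (Real.sqrt 3 : ℂ))] ∧
    AlgebraicIndependent ℚ ![cexp 1, ((Real.Gamma (1 / 3) : ℝ) : ℂ)] ∧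
    (∀ α : ℂ, IsAlgebraic ℚ α → LinearIndependent ℚ ![(1 : ℂ), α] →
      AlgebraicIndependent ℚ ![(Real.pi : ℂ), cexp α]) := by
  have hc : ¬ AlgebraicIndependent ℚ ![cexp 1, (Real.pi : ℂ)] := fun h' =>
    h (expOnePiAlgebraicIndependent_iff_complex.mpr (soloAlgebraicIndependent_pair_swap h'))
  have hc' : ¬ AlgebraicIndependent ℚ ![(Real.pi : ℂ), cexp 1] := fun h' =>
    h (expOnePiAlgebraicIndependent_iff_complex.mpr h')
  refine ⟨?_, ?_, ?_, ?_, ?_⟩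
  · exact algebraicIndependent_expOne_pi_or_expOne_expPi.resolve_left hc
  · exact algebraicIndependent_expOne_pi_or_expOne_gammaQuarter.resolve_left hc
  · exact algebraicIndependent_expOne_pi_or_expOne_expPiSqrtThree.resolve_left hc
  · exact algebraicIndependent_expOne_pi_or_expOne_gammaThird.resolve_left hc
  · intro α hα hli
    exact (algebraicIndependent_pi_expOne_or_pi_exp_of_isAlgebraic hα hli).resolve_left hc'

/-- **Equivalent reading.** `e ⟂ π` holds iff at least one of the transported statements FAILS
to be automatic, e.g. iff `AI(e, e^π) → AI(e, π)`: the open conjecture is exactly the missing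
implication between two of its own instances. [this file] -/
theorem expOnePiAlgebraicIndependent_iff_expPi_imp :
    ExpOnePiAlgebraicIndependent ↔
      (AlgebraicIndependent ℚ ![cexp 1, cexp (Real.pi : ℂ)] →
        AlgebraicIndependent ℚ ![cexp 1, (Real.pi : ℂ)]) := by
  constructor
  · intro h _
    exact soloAlgebraicIndependent_pair_swap (expOnePiAlgebraicIndependent_iff_complex.mp h)
  · intro himp
    by_contra hne
    exact hne (expOnePiAlgebraicIndependent_iff_complex.mpr (soloAlgebraicIndependent_pair_swap
      (himp (counterexampleWorld_inherits hne).1)))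

end Summit.Schanuel.Schanuel.Theorems

end
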